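import Summits.BirchSwinnertonDyer.BirchSwinnertonDyer.Theorems.ResidualThetaTransportAtTwoThetaLayerLambdaCongruenceAtTwoPlusLineGlue
import HarnessLib

/-!
# Crux `ThetaLayerLambdaCongruenceAtTwo` (stmt-BirchSwinnertonDyer-20688, route ResidualThetaTransportAtTwo), line
# `birth`: under the plus-line stub (C3) the UNIT LOCI of the two depleted plus symbols COINCIDE — the `μ`-input of the
# line can be read on the CURVE side (lead prover bsd-wall-rtt-p3 g2; `--supports stmt-BirchSwinnertonDyer-20688 --as
# helper`; closes nothing)

HONEST FRAMING. THEOREMS ONLY; research inputs are explicit hypotheses spelled inline; nothing about any curve or form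
is asserted; BSD is not proved by any of this.

WHAT. Let `Φ₁ = c·φ^{S₀}_W` (primitive integral scaling of the curve's depleted plus symbol, `…CurveSymbolPrimitive`) and
`Φ₂ = φ^{S₀}_{g,Ω}` (the partner's, cohomological `Ω`). If (C3) `PlusLine` holds and `Φ₂` has a unit value SOMEWHERE on
`ℚ`, then the scalar `a` of (C3) is a UNIT (§1, `norm_eq_one_of_congr_of_primitive`) and hence, pointwise,
`‖Φ₁(r)‖ = 1 ⟺ ‖Φ₂(r)‖ = 1` (§1, `norm_eq_one_iff_of_unit_congr`). Consequently (§2,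
`stub_depletedSymbolUnitOneLayer_of_plusLine_curveMax`) the registered stub (μ-sym₁) of skeleton v6/v7 (one unit
partner value at one even layer) FOLLOWS from (C3) + (Ih) «`φ^{S₀}_{g,Ω}` has a unit value somewhere on `ℚ`»
(= the depleted form inherits the cohomological period; Ihara's lemma à la Vatsal §1.6 / EPW §3, printed for odd `p`)
+ (μ-W₁) «the CURVE's depleted rational plus symbol attains its `2`-adic maximum over `ℚ` at some `2`-power cusp of
some even level» — a statement about the rational numbers `[r]⁺_f` of `W` alone, decidable for each curve by a finite
modular-symbol computation, conjecture-grade universally (`μ = 0` for `W` at `2`); and THE CRUX BY NAME from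
(C3) + (Ih) + (μ-W₁) (`thetaLayerLambdaCongruenceAtTwo_of_plusLine_ihara_curveMax`). This is an ALTERNATIVE composition
to skeleton v7 (which keeps (μ-sym₁) on the partner side); the registered skeleton is unchanged.

References: [GreenbergVatsal2000] §1 (10), Prop. (2.4); [Vatsal1999] §1.6; [EmertonPollackWeston2006] §3;
[PollackWeston2011MT] Def. 2.1.
-/

noncomputable section

-- justification: the `Summit.BirchSwinnertonDyer.BirchSwinnertonDyer.…` path repeats a component (route-file convention)
set_option linter.dupNamespace false

open scoped Classical MatrixGroups

open Polynomial CongruenceSubgroup Literature.NumberTheory.EllipticCurves Literature.NumberTheory.EllipticCurves.ModularForms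

namespace Summit.BirchSwinnertonDyer.BirchSwinnertonDyer.Theorems.ThetaLayerLambdaCongruenceAtTwo

/-! ## §1. Ultrametric bookkeeping: a congruence between primitive integral functions has a unit scalar -/

section Ultrametric

variable {K : Type*} [NormedField K] [IsUltrametricDist K]

/-- If `Φ₁, Φ₂ : ℚ → K` are integral, each with a unit value, and `‖a·Φ₁(r) − Φ₂(r)‖ < 1` for all `r`, then `‖a‖ = 1`.
[folklore] -/
theorem norm_eq_one_of_congr_of_primitive {Φ₁ Φ₂ : ℚ → K} {a : K} (h1 : ∀ r, ‖Φ₁ r‖ ≤ 1) (h2 : ∀ r, ‖Φ₂ r‖ ≤ 1)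
    (p1 : ∃ r, ‖Φ₁ r‖ = 1) (p2 : ∃ r, ‖Φ₂ r‖ = 1) (h : ∀ r, ‖a * Φ₁ r - Φ₂ r‖ < 1) : ‖a‖ = 1 := by
  obtain ⟨r₁, hr₁⟩ := p1
  obtain ⟨r₂, hr₂⟩ := p2
  refine le_antisymm ?_ ?_
  · -- at `r₁`: `‖a‖ = ‖a Φ₁ r₁‖ ≤ max ‖aΦ₁ r₁ − Φ₂ r₁‖ ‖Φ₂ r₁‖ ≤ 1`
    by_contra hlt
    push Not at hlt
    have hgt : 1 < ‖a * Φ₁ r₁‖ := by rw [norm_mul, hr₁, mul_one]; exact hlt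
    have hsub : ‖a * Φ₁ r₁‖ ≤ max ‖a * Φ₁ r₁ - Φ₂ r₁‖ ‖Φ₂ r₁‖ := by
      have := IsUltrametricDist.norm_add_le_max (a * Φ₁ r₁ - Φ₂ r₁) (Φ₂ r₁)
      rwa [sub_add_cancel] at this
    have : ‖a * Φ₁ r₁‖ ≤ 1 := hsub.trans (max_le (h r₁).le (h2 r₁))
    linarith
  · -- at `r₂`: `1 = ‖Φ₂ r₂‖ ≤ max ‖aΦ₁ r₂ − Φ₂ r₂‖ ‖aΦ₁ r₂‖`, the first `< 1`
    by_contra hlt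
    push Not at hlt
    have hle : ‖Φ₂ r₂‖ ≤ max ‖Φ₂ r₂ - a * Φ₁ r₂‖ ‖a * Φ₁ r₂‖ := by
      have := IsUltrametricDist.norm_add_le_max (Φ₂ r₂ - a * Φ₁ r₂) (a * Φ₁ r₂)
      rwa [sub_add_cancel] at this
    rw [hr₂, norm_sub_rev] at hle
    have ha1 : ‖a * Φ₁ r₂‖ < 1 := by
      rw [norm_mul]
      exact mul_lt_one_of_nonneg_of_lt_one_left (norm_nonneg _) hlt (h1 r₂)
    have := lt_of_le_of_lt hle (max_lt (h r₂) ha1)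
    exact lt_irrefl _ this

/-- If `‖a‖ = 1`, `‖x‖, ‖y‖ ≤ 1` and `‖a·x − y‖ < 1`, then `‖x‖ = 1 ⟺ ‖y‖ = 1`. [folklore] -/
theorem norm_eq_one_iff_of_unit_congr {a x y : K} (ha : ‖a‖ = 1) (hx : ‖x‖ ≤ 1) (hy : ‖y‖ ≤ 1)
    (h : ‖a * x - y‖ < 1) : ‖x‖ = 1 ↔ ‖y‖ = 1 := by
  have hax : ‖a * x‖ = ‖x‖ := by rw [norm_mul, ha, one_mul]
  constructor
  · intro hx1
    refine le_antisymm hy (not_lt.mp fun hy1 ↦ ?_)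
    have hle : ‖a * x‖ ≤ max ‖a * x - y‖ ‖y‖ := by
      have := IsUltrametricDist.norm_add_le_max (a * x - y) y
      rwa [sub_add_cancel] at this
    rw [hax, hx1] at hle
    exact lt_irrefl _ (lt_of_le_of_lt hle (max_lt h hy1))
  · intro hy1
    refine le_antisymm hx (not_lt.mp fun hx1 ↦ ?_)
    have hle : ‖y‖ ≤ max ‖y - a * x‖ ‖a * x‖ := by
      have := IsUltrametricDist.norm_add_le_max (y - a * x) (a * x)
      rwa [sub_add_cancel] at this
    rw [hy1, norm_sub_rev, hax] at hle
    exact lt_irrefl _ (lt_of_le_of_lt hle (max_lt h hx1))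

end Ultrametric

/-! ## §2. (μ-sym₁) from (C3) + (Ih) + (μ-W₁), and the crux -/

section Transfer

/-- **The partner's one-layer unit (μ-sym₁) FROM the plus line (C3), the primitivity of the partner's depleted symbol
(Ih) and the CURVE-side maximum at a `2`-power cusp (μ-W₁).** Under (C3) the scalar `a` relating `c·φ^{S₀}_W` and
`φ^{S₀}_{g,Ω}` is a unit, so their unit loci coincide; (μ-W₁) puts a maximum of `φ^{S₀}_W` (hence a unit of `c·φ^{S₀}_W`)
at a layer-`n₁` cusp, `n₁` even, which is therefore a unit of `φ^{S₀}_{g,Ω}` too.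
[cite: GreenbergVatsal2000, §1 (10) and Prop. (2.4)] -/
theorem stub_depletedSymbolUnitOneLayer_of_plusLine_curveMax
    (hC3 : ∀ (W : WeierstrassCurve ℚ) [W.IsElliptic] [W.IsGloballyMinimal], Literature.NumberTheory.EllipticCurves.Rank1Residual.GoodSS W 2 → W.Δ < 0 → ∀ (N' : ℕ), Odd N' → (∀ ℓ : ℕ, ℓ.Prime → ℓ ∣ W.conductorNorm ℤ → ℓ ∣ N') → ∀ (Φ₁ Φ₂ : ℚ → PadicAlgCl 2), (∀ (r : ℚ) (z : ℤ), Φ₁ (r + z) = Φ₁ r) → (∀ r : ℚ, Φ₁ (-r) = Φ₁ r) → (∀ (γ : CongruenceSubgroup.Gamma0 (N')) (r : ℚ), ((γ : SL(2, ℤ)) 1 0 : ℚ) * r + ((γ : SL(2, ℤ)) 1 1 : ℚ) ≠ 0 → Φ₁ ((((γ : SL(2, ℤ)) 0 0 : ℚ) * r + ((γ : SL(2, ℤ)) 0 1 : ℚ)) / (((γ : SL(2, ℤ)) 1 0 : ℚ) * r + ((γ : SL(2, ℤ)) 1 1 : ℚ))) = (if ((γ : SL(2, ℤ)) 1 0)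 = 0 then 0 else Φ₁ ((((γ : SL(2, ℤ)) 0 0 : ℚ)) / (((γ : SL(2, ℤ)) 1 0 : ℚ)))) + Φ₁ r) → (∀ (r : ℚ) (z : ℤ), Φ₂ (r + z) = Φ₂ r) → (∀ r : ℚ, Φ₂ (-r) = Φ₂ r) → (∀ (γ : CongruenceSubgroup.Gamma0 (N')) (r : ℚ), ((γ : SL(2, ℤ)) 1 0 : ℚ) * r + ((γ : SL(2, ℤ)) 1 1 : ℚ) ≠ 0 → Φ₂ ((((γ : SL(2, ℤ)) 0 0 : ℚ) * r + ((γ : SL(2, ℤ)) 0 1 : ℚ)) / (((γ : SL(2, ℤ)) 1 0 : ℚ) * r + ((γ : SL(2, ℤ)) 1 1 : ℚ))) = (if ((γ : SL(2, ℤ)) 1 0) = 0 then 0 else Φ₂ ((((γ : SL(2, ℤ)) 0 0 : ℚ)) / (((γ : SL(2, ℤ)) 1 0 : ℚ)))) + Φ₂ r) → (∀ r : ℚ, ‖Φ₁ r‖ ≤ 1) → (∀ r : ℚ, ‖Φ₂ r‖ ≤ 1) → (∃ r : ℚ, ‖Φ₁ r‖ = 1) → (∃ r : ℚ, ‖Φ₂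 r‖ = 1) → (∀ q : ℕ, q.Prime → ¬ q ∣ N' → ∀ r : ℚ, ‖(∑ j : Fin q, Φ₁ ((r + j) / q)) + Φ₁ (q * r) - (W.LFunction q : PadicAlgCl 2) * Φ₁ r‖ < 1) → (∀ q : ℕ, q.Prime → ¬ q ∣ N' → ∀ r : ℚ, ‖(∑ j : Fin q, Φ₂ ((r + j) / q)) + Φ₂ (q * r) - (W.LFunction q : PadicAlgCl 2) * Φ₂ r‖ < 1) → (∀ ℓ : ℕ, ℓ.Prime → ℓ ∣ N' → ∀ r : ℚ, ‖∑ j : Fin ℓ, Φ₁ ((r + j) / ℓ)‖ < 1) → (∀ ℓ : ℕ, ℓ.Prime → ℓ ∣ N' → ∀ r : ℚ, ‖∑ j : Fin ℓ, Φ₂ ((r + j) / ℓ)‖ < 1) → ∃ a : PadicAlgCl 2, ∀ r : ℚ, ‖a * Φ₁ r - Φ₂ r‖ < 1)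
    (hIh : ∀ (W : WeierstrassCurve ℚ) [W.IsElliptic] [W.IsGloballyMinimal], ¬ W.HasCM → W.analyticRank = 0 → Literature.NumberTheory.EllipticCurves.Rank1Residual.GoodSS W 2 → W.frobeniusTrace 2 = 0 → W.Δ < 0 → ∀ (M : ℕ) [NeZero M] (g : CuspForm (CongruenceSubgroup.Gamma0 M) 2) (ι : Literature.NumberTheory.EllipticCurves.ModularForms.coeffField g →+* PadicAlgCl 2) (Ω : ℂ), Odd M → Literature.NumberTheory.EllipticCurves.ModularForms.IsNewform0 g → Literature.NumberTheory.Automorphic.IsCMForm (Literature.NumberTheory.EllipticCurves.ModularForms.liftToGamma1 M 2 g) → Literature.NumberTheory.EllipticCurves.ModularForms.cuspCoeff g 2 = 0 → Literature.NumberTheory.EllipticCurves.IsCohomologicalPlusPeriod g ι Ω → (∀ ℓ : ℕ, ℓ.Prime → ¬ ℓ ∣ 2 * M * W.conductorNorm ℤ → ‖Literature.NumberTheory.EllipticCurves.embCoeff g ι ℓ - (W.frobeniusTrace ℓ : PadicAlgCl 2)‖ < 1) → ∀ [NeZero (W.conductorNorm ℤ)] (f : CuspForm (CongruenceSubgroup.Gamma0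 (W.conductorNorm ℤ)) 2), Literature.NumberTheory.EllipticCurves.ModularForms.IsNewformOf W f → ∀ (S₀ : Finset (IsDedekindDomain.HeightOneSpectrum (NumberField.RingOfIntegers ℚ))), (∀ v ∈ S₀, ((2 : ℕ) : NumberField.RingOfIntegers ℚ) ∉ v.asIdeal) → (∀ v : IsDedekindDomain.HeightOneSpectrum (NumberField.RingOfIntegers ℚ), ¬ W.HasGoodReductionAt v → v ∈ S₀) → (∀ v : IsDedekindDomain.HeightOneSpectrum (NumberField.RingOfIntegers ℚ), Rat.HeightOneSpectrum.natGenerator v ∣ M → v ∈ S₀) → ∃ r : ℚ, ‖(∑ k ∈ Fintype.piFinset (fun _ : S₀ ↦ Finset.range 3), (∏ v : S₀, (1 - Polynomial.C (embCoeff g ι (Rat.HeightOneSpectrum.natGenerator (v : IsDedekindDomain.HeightOneSpectrum (NumberField.RingOfIntegers ℚ)))) * Polynomial.X + (if Rat.HeightOneSpectrum.natGenerator (v : IsDedekindDomain.HeightOneSpectrum (NumberField.RingOfIntegers ℚ)) ∣ M then 0 else Polynomial.C (Rat.HeightOneSpectrum.natGenerator (v : IsDedekindDomain.HeightOneSpectrum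 (NumberField.RingOfIntegers ℚ)) : PadicAlgCl 2)) * Polynomial.X ^ 2 : Polynomial (PadicAlgCl 2)).coeff (k v) * ((Rat.HeightOneSpectrum.natGenerator (v : IsDedekindDomain.HeightOneSpectrum (NumberField.RingOfIntegers ℚ)) : PadicAlgCl 2)⁻¹) ^ (k v)) * ι (plusSymbolK g Ω (r * ((∏ v : S₀, Rat.HeightOneSpectrum.natGenerator (v : IsDedekindDomain.HeightOneSpectrum (NumberField.RingOfIntegers ℚ)) ^ (k v) : ℕ) : ℚ))))‖ = 1)
    (hμW : ∀ (W : WeierstrassCurve ℚ) [W.IsElliptic] [W.IsGloballyMinimal], ¬ W.HasCM → W.analyticRank = 0 → Literature.NumberTheory.EllipticCurves.Rank1Residual.GoodSS W 2 → W.frobeniusTrace 2 = 0 → W.Δ < 0 → ∀ [NeZero (W.conductorNorm ℤ)] (f : CuspForm (CongruenceSubgroup.Gamma0 (W.conductorNorm ℤ)) 2), Literature.NumberTheory.EllipticCurves.ModularForms.IsNewformOf W f → ∀ (S₀ : Finset (IsDedekindDomain.HeightOneSpectrum (NumberField.RingOfIntegers ℚ))), (∀ v ∈ S₀, ((2 :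 ℕ) : NumberField.RingOfIntegers ℚ) ∉ v.asIdeal) → (∀ v : IsDedekindDomain.HeightOneSpectrum (NumberField.RingOfIntegers ℚ), ¬ W.HasGoodReductionAt v → v ∈ S₀) → ∃ n₁ : ℕ, Even n₁ ∧ ∃ s : ZMod (2 ^ n₁), ∀ r : ℚ, ‖(∑ k ∈ Fintype.piFinset (fun _ : S₀ ↦ Finset.range 3), (∏ v : S₀, ((W.localPolynomialAt (v : IsDedekindDomain.HeightOneSpectrum (NumberField.RingOfIntegers ℚ))).map (Int.castRingHom (PadicAlgCl 2))).coeff (k v) * ((Rat.HeightOneSpectrum.natGenerator (v : IsDedekindDomain.HeightOneSpectrum (NumberField.RingOfIntegers ℚ)) : PadicAlgCl 2)⁻¹) ^ (k v)) * algebraMap ℚ (PadicAlgCl 2) (ratPlusSymbol f (r * ((∏ v : S₀, Rat.HeightOneSpectrum.natGenerator (v : IsDedekindDomain.HeightOneSpectrum (NumberField.RingOfIntegers ℚ)) ^ (k v) : ℕ) : ℚ))))‖ ≤ ‖(∑ k ∈ Fintype.piFinset (fun _ : S₀ ↦ Finset.range 3), (∏ v : S₀, ((W.localPolynomialAt (v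 : IsDedekindDomain.HeightOneSpectrum (NumberField.RingOfIntegers ℚ))).map (Int.castRingHom (PadicAlgCl 2))).coeff (k v) * ((Rat.HeightOneSpectrum.natGenerator (v : IsDedekindDomain.HeightOneSpectrum (NumberField.RingOfIntegers ℚ)) : PadicAlgCl 2)⁻¹) ^ (k v)) * algebraMap ℚ (PadicAlgCl 2) (ratPlusSymbol f ((((((cyclotomicGenerator 2 : ZMod (2 ^ (n₁ + 2))) ^ s.val).val : ℚ) / (2 : ℚ) ^ (n₁ + 2))) * ((∏ v : S₀, Rat.HeightOneSpectrum.natGenerator (v : IsDedekindDomain.HeightOneSpectrum (NumberField.RingOfIntegers ℚ)) ^ (k v) : ℕ) : ℚ))))‖) :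
    ∀ (W : WeierstrassCurve ℚ) [W.IsElliptic] [W.IsGloballyMinimal], ¬ W.HasCM → W.analyticRank = 0 → Literature.NumberTheory.EllipticCurves.Rank1Residual.GoodSS W 2 → W.frobeniusTrace 2 = 0 → W.Δ < 0 → ∀ (M : ℕ) [NeZero M] (g : CuspForm (CongruenceSubgroup.Gamma0 M) 2) (ι : Literature.NumberTheory.EllipticCurves.ModularForms.coeffField g →+* PadicAlgCl 2) (Ω : ℂ), Odd M → Literature.NumberTheory.EllipticCurves.ModularForms.IsNewform0 g → Literature.NumberTheory.Automorphic.IsCMForm (Literature.NumberTheory.EllipticCurves.ModularForms.liftToGamma1 M 2 g) → Literature.NumberTheory.EllipticCurves.ModularForms.cuspCoeff g 2 = 0 → Literature.NumberTheory.EllipticCurves.IsCohomologicalPlusPeriod g ι Ω → (∀ ℓ : ℕ, ℓ.Prime → ¬ ℓ ∣ 2 * M * W.conductorNorm ℤ → ‖Literature.NumberTheory.EllipticCurves.embCoeff g ι ℓ - (W.frobeniusTrace ℓ : PadicAlgCl 2)‖ < 1) → ∀ [NeZero (W.conductorNorm ℤ)] (f : CuspForm (CongruenceSubgroup.Gamma0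 (W.conductorNorm ℤ)) 2), Literature.NumberTheory.EllipticCurves.ModularForms.IsNewformOf W f → ∀ (S₀ : Finset (IsDedekindDomain.HeightOneSpectrum (NumberField.RingOfIntegers ℚ))), (∀ v ∈ S₀, ((2 : ℕ) : NumberField.RingOfIntegers ℚ) ∉ v.asIdeal) → (∀ v : IsDedekindDomain.HeightOneSpectrum (NumberField.RingOfIntegers ℚ), ¬ W.HasGoodReductionAt v → v ∈ S₀) → (∀ v : IsDedekindDomain.HeightOneSpectrum (NumberField.RingOfIntegers ℚ), Rat.HeightOneSpectrum.natGenerator v ∣ M → v ∈ S₀) → ∃ n₁ : ℕ, Even n₁ ∧ ∃ s : ZMod (2 ^ n₁), ‖(∑ k ∈ Fintype.piFinset (fun _ : S₀ ↦ Finset.range 3), (∏ v : S₀, (1 - Polynomial.C (Literature.NumberTheory.EllipticCurves.embCoeff g ι (Rat.HeightOneSpectrum.natGenerator (v : IsDedekindDomain.HeightOneSpectrum (NumberField.RingOfIntegers ℚ)))) * Polynomial.X + (if Rat.HeightOneSpectrum.natGenerator (v : IsDedekindDomain.HeightOneSpectrum (NumberField.RingOfIntegers ℚ)) ∣ M then 0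 else Polynomial.C (Rat.HeightOneSpectrum.natGenerator (v : IsDedekindDomain.HeightOneSpectrum (NumberField.RingOfIntegers ℚ)) : PadicAlgCl 2)) * Polynomial.X ^ 2 : Polynomial (PadicAlgCl 2)).coeff (k v) * ((Rat.HeightOneSpectrum.natGenerator (v : IsDedekindDomain.HeightOneSpectrum (NumberField.RingOfIntegers ℚ)) : PadicAlgCl 2)⁻¹) ^ (k v)) * ι (Literature.NumberTheory.EllipticCurves.plusSymbolK g Ω (((((Literature.NumberTheory.EllipticCurves.cyclotomicGenerator 2 : ZMod (2 ^ (n₁ + 2))) ^ s.val).val : ℚ) / (2 : ℚ) ^ (n₁ + 2)) * ((∏ v : S₀, Rat.HeightOneSpectrum.natGenerator (v : IsDedekindDomain.HeightOneSpectrum (NumberField.RingOfIntegers ℚ)) ^ (k v) : ℕ) : ℚ))))‖ = 1 := by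
  intro W _ _ hcm hr hss ha hΔ M _ g ι Ω hodd hnew hcmg ha2 hΩ hcong _ f hf S₀ hS2 hSW hSM
  obtain ⟨n₁, hn₁e, s, hmax⟩ := hμW W hcm hr hss ha hΔ f hf S₀ hS2 hSW
  haveI : NeZero (2 ^ n₁) := ⟨pow_ne_zero _ two_ne_zero⟩
  obtain ⟨c, hcint, x, hx⟩ := exists_primitive_scaling_depletedCurveSymbol hf hr S₀ hS2
  obtain ⟨r₀, hr₀⟩ := hIh W hcm hr hss ha hΔ M g ι Ω hodd hnew hcmg ha2 hΩ hcong f hf S₀ hS2 hSW hSM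
  -- the hypotheses of (C3), as in `stub_depletedSymbolCongruenceTwo_of_plusLine`
  have hN'odd := odd_depletedLevel W hss hodd S₀ hS2
  have hN'W : ∀ ℓ : ℕ, ℓ.Prime → ℓ ∣ W.conductorNorm ℤ →
      ℓ ∣ W.conductorNorm ℤ * M * (∏ v : S₀, Rat.HeightOneSpectrum.natGenerator (v : IsDedekindDomain.HeightOneSpectrum (NumberField.RingOfIntegers ℚ)) ^ 2) :=
    fun ℓ _ h ↦ dvd_mul_of_dvd_left (dvd_mul_of_dvd_left h M) _
  have hdvdW : W.conductorNorm ℤ * (∏ v : S₀, Rat.HeightOneSpectrum.natGenerator (v : IsDedekindDomain.HeightOneSpectrum (NumberField.RingOfIntegers ℚ)) ^ 2) ∣ W.conductorNorm ℤ * M * (∏ v : S₀, Rat.HeightOneSpectrum.natGenerator (v : IsDedekindDomain.HeightOneSpectrum (NumberField.RingOfIntegers ℚ)) ^ 2) :=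
    ⟨M, by ring⟩
  have hdvdM : M * (∏ v : S₀, Rat.HeightOneSpectrum.natGenerator (v : IsDedekindDomain.HeightOneSpectrum (NumberField.RingOfIntegers ℚ)) ^ 2) ∣ W.conductorNorm ℤ * M * (∏ v : S₀, Rat.HeightOneSpectrum.natGenerator (v : IsDedekindDomain.HeightOneSpectrum (NumberField.RingOfIntegers ℚ)) ^ 2) :=
    ⟨W.conductorNorm ℤ, by ring⟩
  have hoff : ∀ q : ℕ, ¬ q ∣ W.conductorNorm ℤ * M * (∏ v : S₀, Rat.HeightOneSpectrum.natGenerator (v : IsDedekindDomain.HeightOneSpectrum (NumberField.RingOfIntegers ℚ)) ^ 2) →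
      ¬ q ∣ W.conductorNorm ℤ ∧ ¬ q ∣ M ∧ ∀ v ∈ S₀, Rat.HeightOneSpectrum.natGenerator v ≠ q :=
    fun q hnd ↦ off_depletedLevel W M S₀ hnd
  have hgint := norm_depletedPartnerSymbol_le_one' g ι Ω S₀ hnew hΩ hS2
  obtain ⟨a, ha'⟩ := hC3 W hss hΔ _ hN'odd hN'W
    (fun x ↦ c * (fun x ↦ ∑ k ∈ Fintype.piFinset (fun _ : S₀ ↦ Finset.range 3), (∏ v : S₀, ((W.localPolynomialAt (v : IsDedekindDomain.HeightOneSpectrum (NumberField.RingOfIntegers ℚ))).map (Int.castRingHom (PadicAlgCl 2))).coeff (k v) * ((Rat.HeightOneSpectrum.natGenerator (v : IsDedekindDomain.HeightOneSpectrum (NumberField.RingOfIntegers ℚ)) : PadicAlgCl 2)⁻¹) ^ (k v)) * algebraMap ℚ (PadicAlgCl 2) (ratPlusSymbol f (x * ((∏ v : S₀, Rat.HeightOneSpectrum.natGenerator (v : IsDedekindDomain.HeightOneSpectrum (NumberField.RingOfIntegers ℚ)) ^ (k v) : ℕ) : ℚ)))) x) (fun x ↦ ∑ k ∈ Fintype.piFinset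 (fun _ : S₀ ↦ Finset.range 3), (∏ v : S₀, (1 - Polynomial.C (embCoeff g ι (Rat.HeightOneSpectrum.natGenerator (v : IsDedekindDomain.HeightOneSpectrum (NumberField.RingOfIntegers ℚ)))) * Polynomial.X + (if Rat.HeightOneSpectrum.natGenerator (v : IsDedekindDomain.HeightOneSpectrum (NumberField.RingOfIntegers ℚ)) ∣ M then 0 else Polynomial.C (Rat.HeightOneSpectrum.natGenerator (v : IsDedekindDomain.HeightOneSpectrum (NumberField.RingOfIntegers ℚ)) : PadicAlgCl 2)) * Polynomial.X ^ 2 : Polynomial (PadicAlgCl 2)).coeff (k v) * ((Rat.HeightOneSpectrum.natGenerator (v : IsDedekindDomain.HeightOneSpectrum (NumberField.RingOfIntegers ℚ)) : PadicAlgCl 2)⁻¹) ^ (k v)) * ι (plusSymbolK g Ω (x * ((∏ v : S₀, Rat.HeightOneSpectrum.natGenerator (v : IsDedekindDomain.HeightOneSpectrum (NumberField.RingOfIntegers ℚ)) ^ (k v) : ℕ) : ℚ))))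
    (depletedCurveSymbol_add_intCast W S₀ c) (depletedCurveSymbol_neg W S₀ c)
    (depletedCurveSymbol_gamma0_smul_of_dvd hf c hdvdW)
    (depletedPartnerSymbol_add_intCast g ι Ω S₀) (depletedPartnerSymbol_neg g ι Ω S₀)
    (depletedPartnerSymbol_gamma0_smul_of_dvd g ι Ω S₀ hΩ.isPlusPeriod hdvdM)
    hcint hgint ⟨x, hx⟩ ⟨r₀, hr₀⟩
    (fun q hq hnd r ↦ by
      rw [depletedCurveSymbol_heckeT_sub_eq_zero hf c hq (hoff q hnd).1 (hoff q hnd).2.2 r, norm_zero]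
      exact zero_lt_one)
    (fun q hq hnd r ↦ depletedPartnerSymbol_heckeT_sub_lt_one g ι Ω S₀ hnew hΩ hS2 W ha2 ha hcong hSW hSM hq
      (hoff q hnd).2.1 (hoff q hnd).2.2 r)
    (fun ℓ hℓ hd r ↦ by
      rw [depletedCurveSymbol_heckeU_eq_zero hf c hSW hSM hℓ hd r, norm_zero]; exact zero_lt_one)
    (fun ℓ hℓ hd r ↦ by
      rw [depletedPartnerSymbol_heckeU_eq_zero g ι Ω S₀ hnew hΩ.isPlusPeriod W hSW hSM hℓ hd r, norm_zero]
      exact zero_lt_one)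
  simp only at ha'
  -- `a` is a unit
  have ha1 : ‖a‖ = 1 :=
    norm_eq_one_of_congr_of_primitive (Φ₁ := fun x ↦ c * (∑ k ∈ Fintype.piFinset (fun _ : S₀ ↦ Finset.range 3), (∏ v : S₀, ((W.localPolynomialAt (v : IsDedekindDomain.HeightOneSpectrum (NumberField.RingOfIntegers ℚ))).map (Int.castRingHom (PadicAlgCl 2))).coeff (k v) * ((Rat.HeightOneSpectrum.natGenerator (v : IsDedekindDomain.HeightOneSpectrum (NumberField.RingOfIntegers ℚ)) : PadicAlgCl 2)⁻¹) ^ (k v)) * algebraMap ℚ (PadicAlgCl 2) (ratPlusSymbol f (x * ((∏ v : S₀, Rat.HeightOneSpectrum.natGenerator (v : IsDedekindDomain.HeightOneSpectrum (NumberField.RingOfIntegers ℚ)) ^ (k v) : ℕ) : ℚ)))))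
      (Φ₂ := fun x ↦ (∑ k ∈ Fintype.piFinset (fun _ : S₀ ↦ Finset.range 3), (∏ v : S₀, (1 - Polynomial.C (embCoeff g ι (Rat.HeightOneSpectrum.natGenerator (v : IsDedekindDomain.HeightOneSpectrum (NumberField.RingOfIntegers ℚ)))) * Polynomial.X + (if Rat.HeightOneSpectrum.natGenerator (v : IsDedekindDomain.HeightOneSpectrum (NumberField.RingOfIntegers ℚ)) ∣ M then 0 else Polynomial.C (Rat.HeightOneSpectrum.natGenerator (v : IsDedekindDomain.HeightOneSpectrum (NumberField.RingOfIntegers ℚ)) : PadicAlgCl 2)) * Polynomial.X ^ 2 : Polynomial (PadicAlgCl 2)).coeff (k v) * ((Rat.HeightOneSpectrum.natGenerator (v : IsDedekindDomain.HeightOneSpectrum (NumberField.RingOfIntegers ℚ)) : PadicAlgCl 2)⁻¹) ^ (k v)) * ι (plusSymbolK g Ω (x * ((∏ v : S₀, Rat.HeightOneSpectrum.natGenerator (v : IsDedekindDomain.HeightOneSpectrum (NumberField.RingOfIntegers ℚ)) ^ (k v) : ℕ) : ℚ))))) hcint hgint ⟨x, hx⟩ ⟨r₀, hr₀⟩ 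ha'
  -- the curve side is a unit at the layer-`n₁` cusp `s`
  have hW1 : ‖c * (∑ k ∈ Fintype.piFinset (fun _ : S₀ ↦ Finset.range 3), (∏ v : S₀, ((W.localPolynomialAt (v : IsDedekindDomain.HeightOneSpectrum (NumberField.RingOfIntegers ℚ))).map (Int.castRingHom (PadicAlgCl 2))).coeff (k v) * ((Rat.HeightOneSpectrum.natGenerator (v : IsDedekindDomain.HeightOneSpectrum (NumberField.RingOfIntegers ℚ)) : PadicAlgCl 2)⁻¹) ^ (k v)) * algebraMap ℚ (PadicAlgCl 2) (ratPlusSymbol f ((((((cyclotomicGenerator 2 : ZMod (2 ^ (n₁ + 2))) ^ s.val).val : ℚ) / (2 : ℚ) ^ (n₁ + 2))) * ((∏ v : S₀, Rat.HeightOneSpectrum.natGenerator (v : IsDedekindDomain.HeightOneSpectrum (NumberField.RingOfIntegers ℚ)) ^ (k v) : ℕ) : ℚ))))‖ = 1 := by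
    refine le_antisymm (hcint _) ?_
    rw [← hx, norm_mul, norm_mul]
    exact mul_le_mul_of_nonneg_left (hmax x) (norm_nonneg c)
  exact ⟨n₁, hn₁e, s, (norm_eq_one_iff_of_unit_congr ha1 (hcint _) (hgint _) (ha' (((((cyclotomicGenerator 2 : ZMod (2 ^ (n₁ + 2))) ^ s.val).val : ℚ) / (2 : ℚ) ^ (n₁ + 2))))).mp hW1⟩

/-- **THE CRUX BY NAME from (C3) + (Ih) + (μ-W₁)** — alternative composition (v7 keeps (μ-sym₁) on the partner side):
plus multiplicity one mod `2` (C3), primitivity of the partner's depleted symbol (Ih; Ihara-type, printed for odd `p`),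
and the CURVE-side statement (μ-W₁) that `W`'s depleted rational plus symbol attains its `2`-adic maximum at a
`2`-power cusp of some even level (per-curve finite check; `μ = 0` for `W` at `2`).
[cite: GreenbergVatsal2000, §1 (10) and Prop. (2.4) (shape; the inputs are hypotheses)] -/
theorem thetaLayerLambdaCongruenceAtTwo_of_plusLine_ihara_curveMax
    (hC3 : ∀ (W : WeierstrassCurve ℚ) [W.IsElliptic] [W.IsGloballyMinimal], Literature.NumberTheory.EllipticCurves.Rank1Residual.GoodSS W 2 → W.Δ < 0 → ∀ (N' : ℕ), Odd N' → (∀ ℓ : ℕ, ℓ.Prime → ℓ ∣ W.conductorNorm ℤ → ℓ ∣ N') → ∀ (Φ₁ Φ₂ : ℚ → PadicAlgCl 2), (∀ (r : ℚ) (z : ℤ), Φ₁ (r + z) = Φ₁ r) → (∀ r : ℚ, Φ₁ (-r) = Φ₁ r) → (∀ (γ : CongruenceSubgroup.Gamma0 (N')) (r : ℚ), ((γ : SL(2, ℤ)) 1 0 : ℚ) * r + ((γ : SL(2, ℤ)) 1 1 : ℚ) ≠ 0 → Φ₁ ((((γ : SL(2, ℤ)) 0 0 : ℚ) * r + ((γ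 : SL(2, ℤ)) 0 1 : ℚ)) / (((γ : SL(2, ℤ)) 1 0 : ℚ) * r + ((γ : SL(2, ℤ)) 1 1 : ℚ))) = (if ((γ : SL(2, ℤ)) 1 0) = 0 then 0 else Φ₁ ((((γ : SL(2, ℤ)) 0 0 : ℚ)) / (((γ : SL(2, ℤ)) 1 0 : ℚ)))) + Φ₁ r) → (∀ (r : ℚ) (z : ℤ), Φ₂ (r + z) = Φ₂ r) → (∀ r : ℚ, Φ₂ (-r) = Φ₂ r) → (∀ (γ : CongruenceSubgroup.Gamma0 (N')) (r : ℚ), ((γ : SL(2, ℤ)) 1 0 : ℚ) * r + ((γ : SL(2, ℤ)) 1 1 : ℚ) ≠ 0 → Φ₂ ((((γ : SL(2, ℤ)) 0 0 : ℚ) * r + ((γ : SL(2, ℤ)) 0 1 : ℚ)) / (((γ : SL(2, ℤ)) 1 0 : ℚ) * r + ((γ : SL(2, ℤ)) 1 1 : ℚ))) = (if ((γ : SL(2, ℤ)) 1 0) = 0 then 0 else Φ₂ ((((γ : SL(2, ℤ)) 0 0 : ℚ)) / (((γ : SL(2, ℤ)) 1 0 : ℚ)))) + Φ₂ r) → (∀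 r : ℚ, ‖Φ₁ r‖ ≤ 1) → (∀ r : ℚ, ‖Φ₂ r‖ ≤ 1) → (∃ r : ℚ, ‖Φ₁ r‖ = 1) → (∃ r : ℚ, ‖Φ₂ r‖ = 1) → (∀ q : ℕ, q.Prime → ¬ q ∣ N' → ∀ r : ℚ, ‖(∑ j : Fin q, Φ₁ ((r + j) / q)) + Φ₁ (q * r) - (W.LFunction q : PadicAlgCl 2) * Φ₁ r‖ < 1) → (∀ q : ℕ, q.Prime → ¬ q ∣ N' → ∀ r : ℚ, ‖(∑ j : Fin q, Φ₂ ((r + j) / q)) + Φ₂ (q * r) - (W.LFunction q : PadicAlgCl 2) * Φ₂ r‖ < 1) → (∀ ℓ : ℕ, ℓ.Prime → ℓ ∣ N' → ∀ r : ℚ, ‖∑ j : Fin ℓ, Φ₁ ((r + j) / ℓ)‖ < 1) → (∀ ℓ : ℕ, ℓ.Prime → ℓ ∣ N' → ∀ r : ℚ, ‖∑ j : Fin ℓ, Φ₂ ((r + j) / ℓ)‖ < 1) → ∃ a : PadicAlgCl 2, ∀ r : ℚ, ‖a * Φ₁ r - Φ₂ r‖ < 1)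
    (hIh : ∀ (W : WeierstrassCurve ℚ) [W.IsElliptic] [W.IsGloballyMinimal], ¬ W.HasCM → W.analyticRank = 0 → Literature.NumberTheory.EllipticCurves.Rank1Residual.GoodSS W 2 → W.frobeniusTrace 2 = 0 → W.Δ < 0 → ∀ (M : ℕ) [NeZero M] (g : CuspForm (CongruenceSubgroup.Gamma0 M) 2) (ι : Literature.NumberTheory.EllipticCurves.ModularForms.coeffField g →+* PadicAlgCl 2) (Ω : ℂ), Odd M → Literature.NumberTheory.EllipticCurves.ModularForms.IsNewform0 g → Literature.NumberTheory.Automorphic.IsCMForm (Literature.NumberTheory.EllipticCurves.ModularForms.liftToGamma1 M 2 g) → Literature.NumberTheory.EllipticCurves.ModularForms.cuspCoeff g 2 = 0 → Literature.NumberTheory.EllipticCurves.IsCohomologicalPlusPeriod g ι Ω → (∀ ℓ : ℕ, ℓ.Prime → ¬ ℓ ∣ 2 * M * W.conductorNorm ℤ → ‖Literature.NumberTheory.EllipticCurves.embCoeff g ι ℓ - (W.frobeniusTrace ℓ : PadicAlgCl 2)‖ < 1) → ∀ [NeZero (W.conductorNorm ℤ)] (f : CuspForm (CongruenceSubgroup.Gamma0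 (W.conductorNorm ℤ)) 2), Literature.NumberTheory.EllipticCurves.ModularForms.IsNewformOf W f → ∀ (S₀ : Finset (IsDedekindDomain.HeightOneSpectrum (NumberField.RingOfIntegers ℚ))), (∀ v ∈ S₀, ((2 : ℕ) : NumberField.RingOfIntegers ℚ) ∉ v.asIdeal) → (∀ v : IsDedekindDomain.HeightOneSpectrum (NumberField.RingOfIntegers ℚ), ¬ W.HasGoodReductionAt v → v ∈ S₀) → (∀ v : IsDedekindDomain.HeightOneSpectrum (NumberField.RingOfIntegers ℚ), Rat.HeightOneSpectrum.natGenerator v ∣ M → v ∈ S₀) → ∃ r : ℚ, ‖(∑ k ∈ Fintype.piFinset (fun _ : S₀ ↦ Finset.range 3), (∏ v : S₀, (1 - Polynomial.C (embCoeff g ι (Rat.HeightOneSpectrum.natGenerator (v : IsDedekindDomain.HeightOneSpectrum (NumberField.RingOfIntegers ℚ)))) * Polynomial.X + (if Rat.HeightOneSpectrum.natGenerator (v : IsDedekindDomain.HeightOneSpectrum (NumberField.RingOfIntegers ℚ)) ∣ M then 0 else Polynomial.C (Rat.HeightOneSpectrum.natGenerator (v : IsDedekindDomain.HeightOneSpectrum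 (NumberField.RingOfIntegers ℚ)) : PadicAlgCl 2)) * Polynomial.X ^ 2 : Polynomial (PadicAlgCl 2)).coeff (k v) * ((Rat.HeightOneSpectrum.natGenerator (v : IsDedekindDomain.HeightOneSpectrum (NumberField.RingOfIntegers ℚ)) : PadicAlgCl 2)⁻¹) ^ (k v)) * ι (plusSymbolK g Ω (r * ((∏ v : S₀, Rat.HeightOneSpectrum.natGenerator (v : IsDedekindDomain.HeightOneSpectrum (NumberField.RingOfIntegers ℚ)) ^ (k v) : ℕ) : ℚ))))‖ = 1)
    (hμW : ∀ (W : WeierstrassCurve ℚ) [W.IsElliptic] [W.IsGloballyMinimal], ¬ W.HasCM → W.analyticRank = 0 → Literature.NumberTheory.EllipticCurves.Rank1Residual.GoodSS W 2 → W.frobeniusTrace 2 = 0 → W.Δ < 0 → ∀ [NeZero (W.conductorNorm ℤ)] (f : CuspForm (CongruenceSubgroup.Gamma0 (W.conductorNorm ℤ)) 2), Literature.NumberTheory.EllipticCurves.ModularForms.IsNewformOf W f → ∀ (S₀ : Finset (IsDedekindDomain.HeightOneSpectrum (NumberField.RingOfIntegers ℚ))), (∀ v ∈ S₀, ((2 :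 ℕ) : NumberField.RingOfIntegers ℚ) ∉ v.asIdeal) → (∀ v : IsDedekindDomain.HeightOneSpectrum (NumberField.RingOfIntegers ℚ), ¬ W.HasGoodReductionAt v → v ∈ S₀) → ∃ n₁ : ℕ, Even n₁ ∧ ∃ s : ZMod (2 ^ n₁), ∀ r : ℚ, ‖(∑ k ∈ Fintype.piFinset (fun _ : S₀ ↦ Finset.range 3), (∏ v : S₀, ((W.localPolynomialAt (v : IsDedekindDomain.HeightOneSpectrum (NumberField.RingOfIntegers ℚ))).map (Int.castRingHom (PadicAlgCl 2))).coeff (k v) * ((Rat.HeightOneSpectrum.natGenerator (v : IsDedekindDomain.HeightOneSpectrum (NumberField.RingOfIntegers ℚ)) : PadicAlgCl 2)⁻¹) ^ (k v)) * algebraMap ℚ (PadicAlgCl 2) (ratPlusSymbol f (r * ((∏ v : S₀, Rat.HeightOneSpectrum.natGenerator (v : IsDedekindDomain.HeightOneSpectrum (NumberField.RingOfIntegers ℚ)) ^ (k v) : ℕ) : ℚ))))‖ ≤ ‖(∑ k ∈ Fintype.piFinset (fun _ : S₀ ↦ Finset.range 3), (∏ v : S₀, ((W.localPolynomialAt (v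 : IsDedekindDomain.HeightOneSpectrum (NumberField.RingOfIntegers ℚ))).map (Int.castRingHom (PadicAlgCl 2))).coeff (k v) * ((Rat.HeightOneSpectrum.natGenerator (v : IsDedekindDomain.HeightOneSpectrum (NumberField.RingOfIntegers ℚ)) : PadicAlgCl 2)⁻¹) ^ (k v)) * algebraMap ℚ (PadicAlgCl 2) (ratPlusSymbol f ((((((cyclotomicGenerator 2 : ZMod (2 ^ (n₁ + 2))) ^ s.val).val : ℚ) / (2 : ℚ) ^ (n₁ + 2))) * ((∏ v : S₀, Rat.HeightOneSpectrum.natGenerator (v : IsDedekindDomain.HeightOneSpectrum (NumberField.RingOfIntegers ℚ)) ^ (k v) : ℕ) : ℚ))))‖) :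
    Summit.BirchSwinnertonDyer.BirchSwinnertonDyer.Theses.ResidualThetaTransportAtTwo.ThetaLayerLambdaCongruenceAtTwo :=
  thetaLayerLambdaCongruenceAtTwo_of_plusLine_oneLayer hC3
    (stub_depletedSymbolUnitOneLayer_of_plusLine_curveMax hC3 hIh hμW)

end Transfer

end Summit.BirchSwinnertonDyer.BirchSwinnertonDyer.Theorems.ThetaLayerLambdaCongruenceAtTwo

end
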